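import Summits.RiemannHypothesis.RiemannHypothesis.Theorems.SoloInformedKunnethDiagonal

/-!
# The squeeze lives on the diagonal, III: finite excess as a convergent sum, and an infinite separating model (solo-informed, T55c)

Two complements to `SoloInformedKunnethDiagonal` (T55a).

* `excessLeOn_iff_summable`: the finitary predicate `ExcessLeOn N C` (every finite `S ⊆ N` has
  `∑_{S} (Re ρ - 1/2) ≤ C`) is LITERALLY "the positive parts `(Re ρ - 1/2)⁺`, `ρ ∈ N`, are summable with
  sum `≤ C`" — the set-indexed form of Titchmarsh's integrated zero density
  `∫_{1/2}^{1} N(σ, T) dσ = ∑_{0 < γ ≤ T} (β - 1/2)⁺` (The theory of the Riemann zeta-function, §9.20) being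
  bounded in `T` (modulo multiplicity: `N` is a set).
* `ExcessLeOn.union_of_re_le_half`: adjoining any points on or left of the critical line does not change
  the excess bound.  Hence (`exists_infinite_distinctTower_not_kunnethTower`) the separating model of T55a can
  be taken INFINITE: the off-line quartet `{1/2 ± 1/4 ± i}` together with the critical-line points
  `1/2 + i n`, `n ∈ ℤ ∖ {0}` — closed under `conj` and `z ↦ 1 - conj z`, inside the open strip, infinite —
  satisfies every off-diagonal Künneth level with the constant `1/2` and violates the full tower for every
  constant.  The objection "the model is finite, a zero set is not" to T55a's separation is thereby void;
  what the model does not have is an Euler product (it is a set, not an `L`-function), which is the point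
  of the census entry (sharpest §2g (viii)): the RH-content of shape (2) is the diagonal power operation,
  and no configuration-level (off-diagonal) axiom recovers it.
-/

noncomputable section

open Complex Set Finset Literature.NumberTheory.LFunctions
open Literature.NumberTheory.LFunctions.ZetaZeros
open scoped ComplexConjugate

namespace Summit.RiemannHypothesis.RiemannHypothesis.Theorems

variable {N L : Set ℂ} {C : ℝ}

/-! ## Finite excess is a convergent sum of positive parts -/

/-- Over a finset of points of `N`, the sum of positive parts `(Re ρ - 1/2)⁺` is at most the excess bound
(apply `ExcessLeOn` to the sub-finset of points strictly right of the line). [folklore] -/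
theorem ExcessLeOn.sum_pos_part_le (h : ExcessLeOn N C) (T : Finset ↥N) :
    ∑ ρ ∈ T, max ((ρ : ℂ).re - 1 / 2) 0 ≤ C := by
  classical
  set P : ↥N → Prop := fun ρ ↦ 1 / 2 < (ρ : ℂ).re with hP
  rw [← Finset.sum_filter_add_sum_filter_not T P]
  have h1 : ∑ ρ ∈ T.filter P, max ((ρ : ℂ).re - 1 / 2) 0
      = ∑ ρ ∈ T.filter P, ((ρ : ℂ).re - 1 / 2) :=
    Finset.sum_congr rfl fun ρ hρ ↦ max_eq_left (by have := (Finset.mem_filter.1 hρ).2; linarith)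
  have h2 : ∑ ρ ∈ T.filter (fun ρ ↦ ¬ P ρ), max ((ρ : ℂ).re - 1 / 2) 0 = 0 :=
    Finset.sum_eq_zero fun ρ hρ ↦ max_eq_right (by
      have := (Finset.mem_filter.1 hρ).2; rw [hP, not_lt] at this; linarith)
  rw [h1, h2, add_zero]
  let S : Finset ℂ := (T.filter P).map (Function.Embedding.subtype (· ∈ N))
  have hS : (↑S : Set ℂ) ⊆ N := by
    intro z hz
    rw [Finset.mem_coe, Finset.mem_map] at hz
    obtain ⟨ρ, -, rfl⟩ := hz
    exact ρ.2
  have h3 := h S hS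
  rwa [Finset.sum_map] at h3

/-- **`ExcessLeOn N C` iff the positive parts `(Re ρ - 1/2)⁺` over `ρ ∈ N` are summable with sum `≤ C`.**
[folklore] -/
theorem excessLeOn_iff_summable :
    ExcessLeOn N C ↔ Summable (fun ρ : ↥N ↦ max ((ρ : ℂ).re - 1 / 2) 0) ∧
      ∑' ρ : ↥N, max ((ρ : ℂ).re - 1 / 2) 0 ≤ C := by
  have hnn : ∀ ρ : ↥N, 0 ≤ max ((ρ : ℂ).re - 1 / 2) 0 := fun _ ↦ le_max_right _ _
  constructor
  · intro h
    have hsum : Summable (fun ρ : ↥N ↦ max ((ρ : ℂ).re - 1 / 2) 0) :=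
      summable_of_sum_le hnn h.sum_pos_part_le
    exact ⟨hsum, hsum.tsum_le_of_sum_le h.sum_pos_part_le⟩
  · rintro ⟨hsum, hle⟩ S hS
    classical
    have hmem : ∀ z ∈ S, z ∈ N := fun z hz ↦ hS (Finset.mem_coe.2 hz)
    calc ∑ ρ ∈ S, (ρ.re - 1 / 2)
        = ∑ ρ ∈ S.subtype (· ∈ N), ((ρ : ℂ).re - 1 / 2) :=
          (Finset.sum_subtype_of_mem (fun z : ℂ ↦ z.re - 1 / 2) hmem).symm
      _ ≤ ∑ ρ ∈ S.subtype (· ∈ N), max ((ρ : ℂ).re - 1 / 2) 0 :=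
          Finset.sum_le_sum fun ρ _ ↦ le_max_left _ _
      _ ≤ ∑' ρ : ↥N, max ((ρ : ℂ).re - 1 / 2) 0 :=
          hsum.sum_le_tsum _ fun ρ _ ↦ hnn ρ
      _ ≤ C := hle

/-! ## Adjoining on-line (or left-of-line) points; an infinite separating model -/

/-- Adjoining points on or left of the critical line does not change the excess bound. [folklore] -/
theorem ExcessLeOn.union_of_re_le_half (h : ExcessLeOn N C) (hL : ∀ z ∈ L, z.re ≤ 1 / 2) :
    ExcessLeOn (N ∪ L) C := by
  classical
  intro S hS
  rw [← Finset.sum_filter_add_sum_filter_not S (· ∈ N)]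
  have h1 : ∑ ρ ∈ S.filter (· ∈ N), (ρ.re - 1 / 2) ≤ C :=
    h _ fun z hz ↦ (Finset.mem_filter.1 (Finset.mem_coe.1 hz)).2
  have h2 : ∑ ρ ∈ S.filter (fun z ↦ ¬ z ∈ N), (ρ.re - 1 / 2) ≤ 0 := by
    refine Finset.sum_nonpos fun z hz ↦ ?_
    obtain ⟨hzS, hzN⟩ := Finset.mem_filter.1 hz
    have hzL : z ∈ L := (hS (Finset.mem_coe.2 hzS)).resolve_left hzN
    linarith [hL z hzL]
  linarith

/-- The critical-line points at non-zero integer heights. [folklore] -/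
def integerLinePoints : Set ℂ := {z | z.re = 1 / 2 ∧ (∃ n : ℤ, z.im = n) ∧ z.im ≠ 0}

/-- The infinite comb: T55a's off-line quartet plus the integer-height critical-line points. [folklore] -/
def offlineComb (c : ℝ) : Set ℂ := offlineQuartet c ∪ integerLinePoints

/-- The comb is infinite (`n ↦ 1/2 + i n`, `n ≥ 1`, is injective into it). [folklore] -/
theorem offlineComb_infinite (c : ℝ) : (offlineComb c).Infinite := by
  have hinj : Function.Injective (fun n : ℕ ↦ (⟨1 / 2, (n : ℝ) + 1⟩ : ℂ)) := by
    intro m n hmn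
    have := congrArg Complex.im hmn
    exact_mod_cast (by simpa using this : (m : ℝ) = n)
  refine Set.infinite_of_injective_forall_mem hinj fun n ↦ Or.inr ⟨rfl, ⟨(n : ℤ) + 1, ?_⟩, ?_⟩
  · push_cast; rfl
  · show (n : ℝ) + 1 ≠ 0
    positivity

/-- The comb is closed under complex conjugation. [folklore] -/
theorem conj_mem_offlineComb {c : ℝ} {z : ℂ} (hz : z ∈ offlineComb c) : conj z ∈ offlineComb c := by
  rcases hz with hz | ⟨h1, ⟨n, hn⟩, h3⟩
  · exact Or.inl (conj_mem_offlineQuartet hz)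
  · refine Or.inr ⟨by rwa [Complex.conj_re], ⟨-n, ?_⟩, ?_⟩
    · rw [Complex.conj_im, hn]; push_cast; ring
    · rw [Complex.conj_im]; exact neg_ne_zero.2 h3

/-- The comb is closed under `z ↦ 1 - conj z`. [folklore] -/
theorem one_sub_conj_mem_offlineComb {c : ℝ} {z : ℂ} (hz : z ∈ offlineComb c) :
    1 - conj z ∈ offlineComb c := by
  rcases hz with hz | ⟨h1, ⟨n, hn⟩, h3⟩
  · exact Or.inl (one_sub_conj_mem_offlineQuartet hz)
  · refine Or.inr ⟨?_, ⟨n, ?_⟩, ?_⟩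
    · rw [Complex.sub_re, Complex.one_re, Complex.conj_re, h1]; norm_num
    · rw [Complex.sub_im, Complex.one_im, Complex.conj_im, hn]; ring
    · rw [Complex.sub_im, Complex.one_im, Complex.conj_im]; simpa using h3

/-- For `0 < c < 1/2` the comb lies in the open critical strip. [folklore] -/
theorem re_mem_Ioo_of_mem_offlineComb {c : ℝ} (hc : 0 < c) (hc' : c < 1 / 2) {z : ℂ}
    (hz : z ∈ offlineComb c) : 0 < z.re ∧ z.re < 1 := by
  rcases hz with hz | ⟨h1, -, -⟩
  · exact re_mem_Ioo_of_mem_offlineQuartet hc hc' hz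
  · rw [h1]; norm_num

/-- The comb has total excess `2c` (the on-line points contribute nothing). [folklore] -/
theorem excessLeOn_offlineComb {c : ℝ} (hc : 0 ≤ c) : ExcessLeOn (offlineComb c) (2 * c) :=
  (excessLeOn_offlineQuartet hc).union_of_re_le_half fun _ hz ↦ hz.1.le

/-- **Infinite separating model.**  An infinite, `conj`- and `(1 - conj ·)`-closed subset of the open strip,
with a point right of the line, satisfying every off-diagonal Künneth level with the constant `1/2` and no
full Künneth tower with any constant. [folklore] -/
theorem exists_infinite_distinctTower_not_kunnethTower :
    ∃ N : Set ℂ, N.Infinite ∧ (∀ z ∈ N, conj z ∈ N) ∧ (∀ z ∈ N, 1 - conj z ∈ N) ∧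
      (∀ z ∈ N, 0 < z.re ∧ z.re < 1) ∧ (∃ z ∈ N, 1 / 2 < z.re) ∧
      (∀ k : ℕ, DistinctKunnethLevelOn N k (1 / 2)) ∧
      ∀ C : ℝ, ¬ ∀ k : ℕ, 1 ≤ k → KunnethLevelOn N k C := by
  refine ⟨offlineComb (1 / 4), offlineComb_infinite _, fun _ ↦ conj_mem_offlineComb,
    fun _ ↦ one_sub_conj_mem_offlineComb,
    fun _ hz ↦ re_mem_Ioo_of_mem_offlineComb (by norm_num) (by norm_num) hz,
    ⟨_, Or.inl (mk_mem_offlineQuartet (1 / 4)), by change (1 : ℝ) / 2 < 1 / 2 + 1 / 4; norm_num⟩,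
    fun k ↦ ?_, fun C h ↦ ?_⟩
  · have h := (distinctKunnethTowerOn_iff_excessLeOn.2 (excessLeOn_offlineComb (c := 1 / 4) (by norm_num))) k
    norm_num at h
    exact h
  · have h1 := re_le_half_of_kunnethTowerOn h (Or.inl (mk_mem_offlineQuartet (1 / 4)))
    change (1 : ℝ) / 2 + 1 / 4 ≤ 1 / 2 at h1
    linarith

end Summit.RiemannHypothesis.RiemannHypothesis.Theorems

end
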